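import Literature.NumberTheory.EllipticCurves.NeronModelLocalCriterion
import Literature.NumberTheory.EllipticCurves.NeronModelTwoOpens
import HarnessLib

/-!
# Gluing a model near `𝔭` to the Néron model away from `𝔭`

Seventh file of the existence programme for Néron models
(`Literature.NumberTheory.EllipticCurves.NeronModelExistence`). It performs the gluing step of
the local-to-global passage of Bosch–Lütkebohmert–Raynaud, *Néron Models*, §1.4, at a single
closed point `𝔭` of `Spec R` (`exists_isNeronModel_of_iso_glue_atPrime`): given

* `f ∈ R` with `𝔭` the only prime containing `f`, and `u ∉ 𝔭` (so `Spec R = D(f) ∪ D(u)`), models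
  `R_u, R_f, R_{fu}, R_𝔭` of `R[1/u]`, `R[1/f]`, `R[1/fu]` and of the local ring at `𝔭` with compatible
  algebra structures,
* a smooth separated quasi-compact `R_u`-scheme `Y` whose base change `Y ×_{R_u} R_𝔭` is a Néron
  model of the `K`-scheme `E` over `R_𝔭` (in the group-free sense `IsSchematicNeronModel`),
* a Néron model `N_f` of `E` over `R_f`, and an isomorphism `Y ×_{R_u} R_{fu} ≅ N_f ×_{R_f} R_{fu}`
  over `R_{fu}`,

the `K`-group scheme `E` has a Néron model over `R`. The glued scheme is the pushout of
`Y ← Y ×_{R_u} R_{fu} → N_f` along open immersions (as in `NeronModelTwoOpens`); its restrictions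
to `D(u)` and `D(f)` are the charts `Y`, `N_f` (`preimage_desc_eq_range_inl/inr` of
`NeronModelSchematic`, Mathlib `IsOpenImmersion.isPullback`), whence it is smooth, separated and
of finite type over `R` (local on the target, for the open cover of `Spec R` by the two models,
`Scheme.Cover.mkOfCovers`), a Néron model over `R_f`, and a Néron model over `R_𝔭` after base
change (`𝒩 ×_R R_𝔭 ≅ (𝒩 ×_R R_u) ×_{R_u} R_𝔭 ≅ Y ×_{R_u} R_𝔭`); the local criterion
`IsSchematicNeronModel.of_away_of_atPrime_of_models` (`NeronModelLocalCriterion`) and the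
automatic group structure (`IsSchematicNeronModel.exists_grp`, BLR 1.2/6) finish. Together with a
model `Y` of the local Néron model over an open neighbourhood of `𝔭` (EGA IV₃ 8.8.2: limits of
schemes) and the comparison of `Y` with `N_f` over a punctured neighbourhood
(`Literature.AlgebraicGeometry.Limits.LocalizationIsoSpread`), this proves the one-bad-prime
gluing fact `exists_isNeronModel_of_away_of_atPrime_of_unique` of `NeronModelGluing`.

## References

* S. Bosch, W. Lütkebohmert, M. Raynaud, *Néron Models*, Springer 1990, §1.2 (Prop. 4, Prop. 6),
  §1.4 (local-to-global passage over a Dedekind scheme). [BLRNeronModels1990]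
* The Stacks project, Tag 01JA (gluing schemes). [StacksProject]
-/

noncomputable section

universe u

namespace Literature.NumberTheory.EllipticCurves

open _root_.AlgebraicGeometry CategoryTheory Limits
open scoped CategoryTheory.Obj

section GlueAtPrime

variable {R : Type u} [CommRing R] {K : Type u} [Field K] [Algebra R K] [IsFractionRing R K]
  (E : Over (Spec (.of K))) [GrpObj E]

/-- **Gluing a model near `𝔭` to the Néron model away from `𝔭`.** Let `R → K` be a ring with its
field of fractions, `f, u ∈ R`, `𝔭` the only prime ideal containing `f`, and `u ∉ 𝔭`, so
that `Spec R = D(f) ∪ D(u)`. Let `R_u, R_f, R_{fu}, R_𝔭` be models of `R[1/u]`, `R[1/f]`, `R[1/fu]`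
and of the local ring at `𝔭`, with compatible algebra structures (`R_{fu}` an `R_u`- and an
`R_f`-algebra, `R_𝔭` an `R_u`-algebra, all mapping compatibly to `K`). Let `Y → Spec R_u` be smooth,
separated and quasi-compact with `Y ×_{R_u} R_𝔭` a Néron model of the `K`-scheme `E` over `R_𝔭`,
let `N_f` be a Néron model of `E` over `R_f` (both in the group-free sense), and let
`ψ : Y ×_{R_u} R_{fu} ≅ N_f ×_{R_f} R_{fu}` be an isomorphism over `R_{fu}`. Then the `K`-group
scheme `E` has a Néron model over `R`: glue the schemes `Y`, `N_f` along `ψ` (pushout along open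
immersions), identify the charts with the restrictions of the glued scheme `𝒩` to `D(u)`, `D(f)`
(as in `NeronModelTwoOpens`), so that `𝒩` is smooth, separated and of finite type over `R`,
`𝒩 ×_R R_f ≅ N_f` is a Néron model over `R_f` and `𝒩 ×_R R_𝔭 ≅ Y ×_{R_u} R_𝔭` one over `R_𝔭`;
conclude by the local criterion `IsSchematicNeronModel.of_away_of_atPrime_of_models` and the
automatic group structure `IsSchematicNeronModel.exists_grp` (BLR 1.2/6). This is the gluing
step of the local-to-global passage of Bosch–Lütkebohmert–Raynaud, *Néron Models*, §1.4.
[cite: BLRNeronModels1990, §1.2 (Prop. 4) and §1.4 (local-to-global passage)] -/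
theorem exists_isNeronModel_of_iso_glue_atPrime (f u : R) (p : Ideal R) [p.IsPrime] (hV : ∀ q : Ideal R, q.IsPrime → f ∈ q → q = p) (hup : u ∉ p)
    (Ru : Type u) [CommRing Ru] [Algebra R Ru] [IsLocalization.Away u Ru] [Algebra Ru K]
    [IsScalarTower R Ru K]
    (Rf : Type u) [CommRing Rf] [Algebra R Rf] [IsLocalization.Away f Rf] [Algebra Rf K]
    [IsScalarTower R Rf K]
    (Rfu : Type u) [CommRing Rfu] [Algebra R Rfu] [Algebra Ru Rfu] [Algebra Rf Rfu]
    [IsScalarTower R Ru Rfu] [IsScalarTower R Rf Rfu] [IsLocalization.Away (algebraMap R Ru f) Rfu]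
    [IsLocalization.Away (algebraMap R Rf u) Rfu] [Algebra Rfu K] [IsScalarTower Ru Rfu K]
    [IsScalarTower Rf Rfu K]
    (Rp : Type u) [CommRing Rp] [Algebra R Rp] [IsLocalization.AtPrime Rp p] [Algebra Rp K]
    [IsScalarTower R Rp K] [Algebra Ru Rp] [IsScalarTower R Ru Rp]
    (Y : Over (Spec (.of Ru))) (hYsm : Smooth Y.hom) (hYsep : IsSeparated Y.hom)
    (hYqc : QuasiCompact Y.hom)
    (HY : IsSchematicNeronModel Rp K ((Over.pullback (specOfAlgebraMap Ru Rp)).obj Y) E)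
    (Nf : Over (Spec (.of Rf))) (HNf : IsSchematicNeronModel Rf K Nf E)
    (ψ : (Over.pullback (specOfAlgebraMap Ru Rfu)).obj Y ≅
      (Over.pullback (specOfAlgebraMap Rf Rfu)).obj Nf) :
    ∃ 𝒩 : Grp (Over (Spec (.of R))), IsNeronModel R K 𝒩.X E := by
  -- the charts of the base
  haveI : IsOpenImmersion (specOfAlgebraMap R Ru) := IsOpenImmersion.of_isLocalization u
  haveI : IsOpenImmersion (specOfAlgebraMap R Rf) := IsOpenImmersion.of_isLocalization f
  haveI : IsOpenImmersion (specOfAlgebraMap Ru Rfu) :=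
    IsOpenImmersion.of_isLocalization (algebraMap R Ru f)
  haveI : IsOpenImmersion (specOfAlgebraMap Rf Rfu) :=
    IsOpenImmersion.of_isLocalization (algebraMap R Rf u)
  have hφ : specOfAlgebraMap Ru Rfu ≫ specOfAlgebraMap R Ru =
      specOfAlgebraMap Rf Rfu ≫ specOfAlgebraMap R Rf := by
    simp only [specOfAlgebraMap, ← Spec.map_comp, ← CommRingCat.ofHom_comp,
      ← IsScalarTower.algebraMap_eq]
  -- glue the schemes `Y`, `Nf` along `ψ`
  let Y' : Over (Spec (.of Rfu)) := (Over.pullback (specOfAlgebraMap Ru Rfu)).obj Y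
  let Nf' : Over (Spec (.of Rfu)) := (Over.pullback (specOfAlgebraMap Rf Rfu)).obj Nf
  let fa : Y'.left ⟶ Y.left := pullback.fst Y.hom (specOfAlgebraMap Ru Rfu)
  let fb : Nf'.left ⟶ Nf.left := pullback.fst Nf.hom (specOfAlgebraMap Rf Rfu)
  let g : Y'.left ⟶ Nf.left := ψ.hom.left ≫ fb
  haveI hfa : IsOpenImmersion fa := by
    change IsOpenImmersion (pullback.fst Y.hom (specOfAlgebraMap Ru Rfu)); infer_instance
  haveI hfb : IsOpenImmersion fb := by
    change IsOpenImmersion (pullback.fst Nf.hom (specOfAlgebraMap Rf Rfu)); infer_instance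
  haveI : IsIso ψ.hom.left := by
    change IsIso ((Over.forget _).map ψ.hom); infer_instance
  haveI hψ : IsOpenImmersion ψ.hom.left := IsOpenImmersion.of_isIso _
  haveI hg : IsOpenImmersion g := @IsOpenImmersion.comp _ _ _ _ _ hψ hfb
  have h1 : fa ≫ Y.hom = Y'.hom ≫ specOfAlgebraMap Ru Rfu := pullback.condition
  have h2 : fb ≫ Nf.hom = Nf'.hom ≫ specOfAlgebraMap Rf Rfu := pullback.condition
  have h3 : ψ.hom.left ≫ Nf'.hom = Y'.hom := Over.w ψ.hom
  have w : fa ≫ Y.hom ≫ specOfAlgebraMap R Ru = g ≫ Nf.hom ≫ specOfAlgebraMap R Rf := by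
    calc fa ≫ Y.hom ≫ specOfAlgebraMap R Ru
        = (Y'.hom ≫ specOfAlgebraMap Ru Rfu) ≫ specOfAlgebraMap R Ru := by
          rw [← Category.assoc, h1]
      _ = Y'.hom ≫ specOfAlgebraMap Rf Rfu ≫ specOfAlgebraMap R Rf := by
          rw [Category.assoc, hφ]
      _ = (ψ.hom.left ≫ Nf'.hom) ≫ specOfAlgebraMap Rf Rfu ≫ specOfAlgebraMap R Rf := by rw [h3]
      _ = ψ.hom.left ≫ (fb ≫ Nf.hom) ≫ specOfAlgebraMap R Rf := by
          rw [h2, Category.assoc, Category.assoc]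
      _ = g ≫ Nf.hom ≫ specOfAlgebraMap R Rf := by
          simp only [g, Category.assoc]
  let X := pushout fa g
  let pX : X ⟶ Spec (.of R) :=
    pushout.desc (Y.hom ≫ specOfAlgebraMap R Ru) (Nf.hom ≫ specOfAlgebraMap R Rf) w
  let 𝒩 : Over (Spec (.of R)) := Over.mk pX
  haveI : IsOpenImmersion (pushout.inl fa g) :=
    Scheme.IsLocallyDirected.instIsOpenImmersionι (span fa g) WalkingSpan.left
  haveI : IsOpenImmersion (pushout.inr fa g) :=
    Scheme.IsLocallyDirected.instIsOpenImmersionι (span fa g) WalkingSpan.right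
  -- ranges: `D(u) ∩ D(f)` seen from the two charts
  have hra : Set.range (specOfAlgebraMap Ru Rfu) =
      specOfAlgebraMap R Ru ⁻¹' Set.range (specOfAlgebraMap R Rf) := by
    rw [range_specOfAlgebraMap (algebraMap R Ru f) Rfu, range_specOfAlgebraMap f Rf]
    ext q
    exact Iff.rfl
  have hrb : Set.range (specOfAlgebraMap Rf Rfu) =
      specOfAlgebraMap R Rf ⁻¹' Set.range (specOfAlgebraMap R Ru) := by
    rw [range_specOfAlgebraMap (algebraMap R Rf u) Rfu, range_specOfAlgebraMap u Ru]
    ext q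
    exact Iff.rfl
  -- chart `u`: `Y ≅ 𝒩 ×_R R_u`
  have Ha : pushout.inl fa g ≫ pX = Y.hom ≫ specOfAlgebraMap R Ru := pushout.inl_desc _ _ _
  have Ha' : pX ⁻¹ᵁ (specOfAlgebraMap R Ru).opensRange = (pushout.inl fa g).opensRange := by
    ext1
    refine preimage_desc_eq_range_inl fa g _ _ w (Set.range (specOfAlgebraMap R Ru)) ?_ ?_
    · intro y; exact ⟨Y.hom y, rfl⟩
    · intro z hz
      have hz' : z ∈ Set.range (pullback.fst Nf.hom (specOfAlgebraMap Rf Rfu)) := by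
        rw [Scheme.Pullback.range_fst, hrb]
        exact hz
      obtain ⟨z', rfl⟩ := hz'
      refine ⟨ψ.inv.left z', ?_⟩
      change (ψ.inv.left ≫ ψ.hom.left ≫ fb) z' = fb z'
      rw [← Category.assoc, ← Over.comp_left, Iso.inv_hom_id, Over.id_left, Category.id_comp]
  have sqa : IsPullback Y.hom (pushout.inl fa g) (specOfAlgebraMap R Ru) pX :=
    IsOpenImmersion.isPullback _ _ _ _ Ha Ha'
  let ea : Y ≅ (Over.pullback (specOfAlgebraMap R Ru)).obj 𝒩 :=
    Over.isoMk sqa.flip.isoPullback sqa.flip.isoPullback_hom_snd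
  -- chart `f`: `Nf ≅ 𝒩 ×_R R_f`
  have Hb : pushout.inr fa g ≫ pX = Nf.hom ≫ specOfAlgebraMap R Rf := pushout.inr_desc _ _ _
  have Hb' : pX ⁻¹ᵁ (specOfAlgebraMap R Rf).opensRange = (pushout.inr fa g).opensRange := by
    ext1
    refine preimage_desc_eq_range_inr fa g _ _ w (Set.range (specOfAlgebraMap R Rf)) ?_ ?_
    · intro z; exact ⟨Nf.hom z, rfl⟩
    · intro y hy
      change y ∈ Set.range (pullback.fst Y.hom (specOfAlgebraMap Ru Rfu))
      rw [Scheme.Pullback.range_fst, hra]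
      exact hy
  have sqb : IsPullback Nf.hom (pushout.inr fa g) (specOfAlgebraMap R Rf) pX :=
    IsOpenImmersion.isPullback _ _ _ _ Hb Hb'
  let eb : Nf ≅ (Over.pullback (specOfAlgebraMap R Rf)).obj 𝒩 :=
    Over.isoMk sqb.flip.isoPullback sqb.flip.isoPullback_hom_snd
  have hNf𝒩 : IsSchematicNeronModel Rf K ((Over.pullback (specOfAlgebraMap R Rf)).obj 𝒩) E :=
    HNf.of_iso_left eb
  -- the structure morphism of `𝒩`: smooth, separated, of finite type (local on the target)
  have hspan : Ideal.span ({u, f} : Set R) = ⊤ := by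
    by_contra hne
    obtain ⟨m, hm, hle⟩ := Ideal.exists_le_maximal _ hne
    have hfm : f ∈ m := hle (Ideal.subset_span (by simp))
    have hum : u ∈ m := hle (Ideal.subset_span (by simp))
    exact hup ((hV m hm.isPrime hfm) ▸ hum)
  let 𝒰 : (Spec (CommRingCat.of R)).OpenCover :=
    Scheme.Cover.mkOfCovers (P := @IsOpenImmersion) Bool
      (fun b => Bool.rec (motive := fun _ => Scheme.{u}) (Spec (.of Rf)) (Spec (.of Ru)) b)
      (fun b => Bool.rec
        (motive := fun b =>
          (Bool.rec (motive := fun _ => Scheme.{u}) (Spec (.of Rf)) (Spec (.of Ru)) b) ⟶ Spec (.of R))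
        (specOfAlgebraMap R Rf) (specOfAlgebraMap R Ru) b)
      (by
        intro x
        by_cases hx : u ∈ x.asIdeal
        · have hfx : f ∉ x.asIdeal := fun hfx => x.2.ne_top (top_le_iff.mp (hspan ▸
            Ideal.span_le.mpr (Set.insert_subset_iff.mpr ⟨hx, Set.singleton_subset_iff.mpr hfx⟩)))
          have : x ∈ Set.range (specOfAlgebraMap R Rf) := by
            rw [range_specOfAlgebraMap f Rf]; exact hfx
          obtain ⟨y, hy⟩ := this
          exact ⟨false, y, hy⟩
        · have : x ∈ Set.range (specOfAlgebraMap R Ru) := by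
            rw [range_specOfAlgebraMap u Ru]; exact hx
          obtain ⟨y, hy⟩ := this
          exact ⟨true, y, hy⟩)
      (by
        rintro (_ | _)
        · exact (inferInstance : IsOpenImmersion (specOfAlgebraMap R Rf))
        · exact (inferInstance : IsOpenImmersion (specOfAlgebraMap R Ru)))
  have hY𝒩 : ∀ (P : MorphismProperty Scheme.{u}) [P.RespectsIso], P Y.hom →
      P ((Over.pullback (specOfAlgebraMap R Ru)).obj 𝒩).hom := fun P _ h =>
    (MorphismProperty.comma_iso_iff P ea).mp h
  have hsm : Smooth 𝒩.hom := by
    rw [IsZariskiLocalAtTarget.iff_of_openCover (P := @Smooth) 𝒰]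
    rintro (_ | _)
    · exact hNf𝒩.smooth
    · exact hY𝒩 @Smooth hYsm
  have hsep : IsSeparated 𝒩.hom := by
    rw [IsZariskiLocalAtTarget.iff_of_openCover (P := @IsSeparated) 𝒰]
    rintro (_ | _)
    · exact hNf𝒩.isSeparated
    · exact hY𝒩 @IsSeparated hYsep
  have hlft : LocallyOfFiniteType 𝒩.hom := by
    rw [IsZariskiLocalAtTarget.iff_of_openCover (P := @LocallyOfFiniteType) 𝒰]
    rintro (_ | _)
    · exact hNf𝒩.locallyOfFiniteType
    · haveI := hYsm
      exact hY𝒩 @LocallyOfFiniteType inferInstance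
  have hqc : QuasiCompact 𝒩.hom := by
    rw [IsZariskiLocalAtTarget.iff_of_openCover (P := @QuasiCompact) 𝒰]
    rintro (_ | _)
    · exact hNf𝒩.quasiCompact
    · exact hY𝒩 @QuasiCompact hYqc
  -- the restriction to `R_𝔭`: `𝒩 ×_R R_𝔭 ≅ (𝒩 ×_R R_u) ×_{R_u} R_𝔭 ≅ Y ×_{R_u} R_𝔭`
  have heq : specOfAlgebraMap Ru Rp ≫ specOfAlgebraMap R Ru = specOfAlgebraMap R Rp := by
    simp only [specOfAlgebraMap, ← Spec.map_comp, ← CommRingCat.ofHom_comp,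
      ← IsScalarTower.algebraMap_eq R Ru Rp]
  have hP𝒩 : IsSchematicNeronModel Rp K ((Over.pullback (specOfAlgebraMap R Rp)).obj 𝒩) E :=
    HY.of_iso_left
      (((Over.pullback (specOfAlgebraMap Ru Rp)).mapIso ea) ≪≫
        pullbackPullbackIso (specOfAlgebraMap R Ru) (specOfAlgebraMap Ru Rp) 𝒩 ≪≫
        Over.isoMk (pullback.congrHom rfl heq)
          ((pullback.lift_snd _ _ _).trans (Category.comp_id _)))
  obtain ⟨𝒢, -, h𝒢⟩ := (IsSchematicNeronModel.of_away_of_atPrime_of_models f p hV hsm hsep hlft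
    hqc Rf Rp hNf𝒩 hP𝒩).exists_grp
  exact ⟨𝒢, h𝒢⟩

end GlueAtPrime

end Literature.NumberTheory.EllipticCurves

end
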